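import Mathlib.RingTheory.Ideal.AssociatedPrime.Basic
import Summits.ResolutionOfSingularities.ResolutionOfSingularities.Theorems.WeightedInvariantE2CoreInvariance
import Summits.ResolutionOfSingularities.ResolutionOfSingularities.Theorems.WeightedInvariantE2SpanContraction
import HarnessLib

/-!
# E2 centre, ring-level hand: the (hom) KERNEL — an ideal whose localisations at its ASSOCIATED PRIMES and at their
# HOMOGENEOUS CORES are twist-related (e.g. both read by the intrinsic `J`) is HOMOGENEOUS

[OURS · L1 W4.3 · DOOR `HypersurfaceCentreConstruction` stmt-ResolutionOfSingularities-19897 · E2 tier, centre piece (C-c)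
`E2CentreGlueBody`, clause (hom) = board item (o47-hom) / SPEC (Δ11b) word `E2CentreHomBody` (registrar res-L1-w43-plan-1,
`L/res-L1-w43-plan-1/E2Step_split_sketch.lean` rev 10; DESIGN MEMO v0 §3 (G-6)); ring-level hand res-L1-s36-pv-1 (first
refusal 20:07:49Z).  Commutative algebra on OUR clause vocabulary ((c11)≤e `IotaJEssSmoothCompatibleLE`, `JUnitInvariant`);
nothing here is a statement of, or about, the manuscript under adjudication (Hironaka 2017); candidate-design support,
AI-written, weaker than expert review.]

## The mechanism

`A` Noetherian, graded by `𝒜 : (Fin j → ℤ) → AddSubgroup A`, `I ≤ A` an ideal.  An element lies in `I` iff it does so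
locally at every ASSOCIATED prime of `A ⧸ I` (`mem_of_forall_associatedPrimes`).  Fix such a prime `𝔮` (NOT assumed
homogeneous), its core `𝔮*`, the generic translate `B = A[M]_{𝔮·A[M]}` with its two legs
`ψ₁ : A_𝔮 → B` (along `ι₀`) and `ψ₂ : A_{𝔮*} → B` (along the coaction `ρ`) of `…E2CoreInvariance`.  TWIST-STABILITY of
`I` at `𝔮` means `(I·A_{𝔮*})·B ≤ (I·A_𝔮)·B` (extensions along `ψ₂`, `ψ₁`).  Then for `a ∈ I`:
`ρ a ∈ (I·A_𝔮)·B ∩ A[M]`, so `s · ρ a ∈ 𝔞·A[M]` for some `s ∉ 𝔮·A[M]` and `𝔞 = A ∩ I·A_𝔮`; res-D-pv-031's saturation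
`E2Span.mem_map_comap_of_mul_mem_of_ne_top` (Krull, `…E2SpanContraction`) removes `s`, and the coefficients of `ρ a` —
the homogeneous components of `a` — lie in `𝔞`, i.e. in `I` locally at `𝔮`.  Hence:

* `isHomogeneous_of_twistStable_associatedPrimes` — twist-stability at every associated prime ⇒ `I` homogeneous;
* `isHomogeneous_of_J_reading_associatedPrimes` — THE (hom) KERNEL FOR THE E2 CENTRE: if at every associated prime
  `𝔮` of `A ⧸ I` the ring `A_𝔮` is regular of dimension `≤ e` and `I` is READ BY `J` both at `𝔮` and at `𝔮*`
  (`I·A_𝔮 = J(A_𝔮, F)_n`, `I·A_{𝔮*} = J(A_{𝔮*}, F)_n`, `F` homogeneous), then `I` is homogeneous — twist-stability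
  being `E2Model.J_map_localization_homogeneousCore_eq` ((c11)≤e + `JUnitInvariant`).

Scheme-level use ((G-6), hand res-D-pv-048/031): `I = R_n(W)` on an affine open `W` with ANY grading of `Γ(W)` making
the local equation homogeneous; the associated primes of `Γ(W) ⧸ R_n(W)` are generic points `ζ` of components of the model
zero sets `Z_ℓ` (by `E2Model.associatedPrimes_quotient_subset_minimalPrimes` chartwise), at which — and at whose cores,
generisations inside the same chart `D(h_ℓ)` with `ι` and `ord` preserved (`…E2CoreInvariance`) — the (open″) iff/J
clauses give exactly the `J`-reading.  No maximality, no orbit-genericity and no density enter.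
-/

set_option linter.dupNamespace false

noncomputable section

open IsLocalRing AddMonoidAlgebra SetLike
open Literature.AlgebraicGeometry.Resolution
open Summit.ResolutionOfSingularities.ResolutionOfSingularities.Theorems.DatumToEmbedded.CentreHomogeneous
open Summit.ResolutionOfSingularities.ResolutionOfSingularities.Theorems.OrbitCentreHomogeneous

namespace Summit.ResolutionOfSingularities.ResolutionOfSingularities.Cruxes.HypersurfaceCentreConstruction.LocalEngine

namespace E2Model

variable {j : ℕ} {A : Type} [CommRing A] [IsNoetherianRing A] (𝒜 : (Fin j → ℤ) → AddSubgroup A) [GradedRing 𝒜]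

omit [GradedRing 𝒜] in
/-- **Local-global at the associated primes**: `x ∈ I` as soon as, for every associated prime `P` of `A ⧸ I`, some
`s ∉ P` has `s x ∈ I` (Noetherian `A`). [OURS · folklore bookkeeping] -/
theorem mem_of_forall_associatedPrimes (I : Ideal A) (x : A)
    (h : ∀ P ∈ associatedPrimes A (A ⧸ I), ∃ s ∉ P, s * x ∈ I) : x ∈ I := by
  by_contra hx
  have hne : Ideal.Quotient.mk I x ≠ 0 := fun h0 => hx (Ideal.Quotient.eq_zero_iff_mem.mp h0)
  obtain ⟨P, hPass, hle⟩ := exists_le_isAssociatedPrime_of_isNoetherianRing A (Ideal.Quotient.mk I x) hne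
  obtain ⟨s, hsP, hsx⟩ := h P hPass
  refine hsP (hle ?_)
  rw [Submodule.mem_colon_singleton, Submodule.mem_bot, Algebra.smul_def, Ideal.Quotient.algebraMap_eq, ← map_mul,
    Ideal.Quotient.eq_zero_iff_mem]
  exact hsx

omit [GradedRing 𝒜] in
/-- An associated prime of `A ⧸ I` contains `I`, so `I·A_𝔮 ≠ ⊤`. [OURS · bookkeeping] -/
theorem map_ne_top_of_mem_associatedPrimes {I 𝔮 : Ideal A} (h𝔮 : 𝔮 ∈ associatedPrimes A (A ⧸ I)) [𝔮.IsPrime] :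
    I.map (algebraMap A (Localization.AtPrime 𝔮)) ≠ ⊤ := by
  have hI𝔮 : I ≤ 𝔮 := by
    obtain ⟨-, z, hz⟩ := (isAssociatedPrime_iff.mp h𝔮)
    intro a ha
    rw [hz, Submodule.mem_colon_singleton, Submodule.mem_bot]
    obtain ⟨z, rfl⟩ := Ideal.Quotient.mk_surjective z
    rw [Algebra.smul_def, Ideal.Quotient.algebraMap_eq, ← map_mul, Ideal.Quotient.eq_zero_iff_mem]
    exact I.mul_mem_right _ ha
  intro htop
  have h1 : (1 : Localization.AtPrime 𝔮) ∈ I.map (algebraMap A (Localization.AtPrime 𝔮)) := htop ▸ Submodule.mem_top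
  rw [← map_one (algebraMap A (Localization.AtPrime 𝔮)),
    IsLocalization.algebraMap_mem_map_algebraMap_iff 𝔮.primeCompl] at h1
  obtain ⟨m, hm, hm1⟩ := h1
  exact hm (hI𝔮 (by simpa using hm1))

/-- **TWIST-STABLE AT THE ASSOCIATED PRIMES ⇒ HOMOGENEOUS.**  If for every associated prime `𝔮` of `A ⧸ I`, with core
`𝔮*` and generic translate `B = A[M]_{𝔮A[M]}`, the extension of `I·A_{𝔮*}` to `B` along the coaction leg lies in the
extension of `I·A_𝔮` along `ι₀`, then `I` is homogeneous. [OURS · (o47-hom) ring kernel] -/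
theorem isHomogeneous_of_twistStable_associatedPrimes (I : Ideal A)
    (h : ∀ 𝔮 ∈ associatedPrimes A (A ⧸ I), ∀ (_ : 𝔮.IsPrime) (𝔮' : Ideal A) (_ : 𝔮'.IsPrime),
      𝔮' = (𝔮.homogeneousCore 𝒜).toIdeal →
      ∀ (ρ : A →+* A[Fin j → ℤ]), (∀ (i : Fin j → ℤ) (a : A), a ∈ 𝒜 i → ρ a = single i a) →
      ∀ (𝔔 : Ideal A[Fin j → ℤ]) (_ : 𝔔.IsPrime), 𝔔 = 𝔮.map (singleZeroRingHom : A →+* A[Fin j → ℤ]) →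
      ∀ (h1 : 𝔮 = 𝔔.comap (singleZeroRingHom : A →+* A[Fin j → ℤ])) (h2 : 𝔮' = 𝔔.comap ρ),
      (I.map (algebraMap A (Localization.AtPrime 𝔮'))).map (Localization.localRingHom 𝔮' 𝔔 ρ h2) ≤
        (I.map (algebraMap A (Localization.AtPrime 𝔮))).map (Localization.localRingHom 𝔮 𝔔 singleZeroRingHom h1)) :
    I.IsHomogeneous 𝒜 := by
  classical
  intro d a ha
  refine mem_of_forall_associatedPrimes I _ fun 𝔮 h𝔮 => ?_
  haveI h𝔮p : 𝔮.IsPrime := (AssociatedPrimes.mem_iff.mp h𝔮).isPrime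
  haveI h𝔮'p : (𝔮.homogeneousCore 𝒜).toIdeal.IsPrime := isPrime_homogeneousCore 𝒜 h𝔮p
  obtain ⟨ρ, hρ, 𝔔, h𝔔p, h𝔔, h1, h2⟩ := exists_translate 𝒜 𝔮 (𝔮.homogeneousCore 𝒜).toIdeal rfl
  have hle := h 𝔮 h𝔮 h𝔮p _ h𝔮'p rfl ρ hρ 𝔔 h𝔔p h𝔔 h1 h2
  -- `ρ a ∈ (I·A_𝔮)·B ∩ A[M]`
  have hρa : algebraMap A[Fin j → ℤ] (Localization.AtPrime 𝔔) (ρ a) ∈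
      (I.map (singleZeroRingHom : A →+* A[Fin j → ℤ])).map (algebraMap A[Fin j → ℤ] (Localization.AtPrime 𝔔)) := by
    have hmem : Localization.localRingHom _ 𝔔 ρ h2 (algebraMap A (Localization.AtPrime (𝔮.homogeneousCore 𝒜).toIdeal) a)
        ∈ (I.map (algebraMap A (Localization.AtPrime 𝔮))).map (Localization.localRingHom 𝔮 𝔔 singleZeroRingHom h1) :=
      hle (Ideal.mem_map_of_mem _ (Ideal.mem_map_of_mem _ ha))
    rw [Localization.localRingHom_to_map, Ideal.map_map] at hmem
    have hcomp : (Localization.localRingHom 𝔮 𝔔 singleZeroRingHom h1).comp (algebraMap A (Localization.AtPrime 𝔮)) =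
        (algebraMap A[Fin j → ℤ] (Localization.AtPrime 𝔔)).comp singleZeroRingHom := by
      ext b
      exact Localization.localRingHom_to_map 𝔮 𝔔 singleZeroRingHom h1 b
    rwa [hcomp, ← Ideal.map_map] at hmem
  obtain ⟨s, hs, hsa⟩ :=
    (IsLocalization.algebraMap_mem_map_algebraMap_iff 𝔔.primeCompl (Localization.AtPrime 𝔔) _ (ρ a)).mp hρa
  -- `s ∉ 𝔮·A[M]`: some coefficient of `s` lies outside `𝔮`
  have hcoeff : ∃ m₀, s.coeff m₀ ∉ 𝔮 := by
    by_contra hall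
    simp only [not_exists, not_not] at hall
    exact hs (h𝔔 ▸ mem_map_of_coeff_mem hall)
  obtain ⟨m₀, hm₀⟩ := hcoeff
  -- saturation at `𝔞 = A ∩ I·A_𝔮` (res-D-pv-031's Krull version of E1's kernel)
  set 𝔞 : Ideal A := (I.map (algebraMap A (Localization.AtPrime 𝔮))).comap (algebraMap A (Localization.AtPrime 𝔮))
    with h𝔞
  have hI𝔞 : I ≤ 𝔞 := Ideal.le_comap_map
  have hsa' : s * ρ a ∈ 𝔞.map (singleZeroRingHom : A →+* A[Fin j → ℤ]) := Ideal.map_mono hI𝔞 hsa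
  have hρa' : ρ a ∈ 𝔞.map (singleZeroRingHom : A →+* A[Fin j → ℤ]) :=
    E2Span.mem_map_comap_of_mul_mem_of_ne_top 𝔮 (Localization.AtPrime 𝔮) _
      (map_ne_top_of_mem_associatedPrimes h𝔮) hm₀ hsa'
  -- the `d`-th coefficient of `ρ a` is the component `a_d`
  have hd : (DirectSum.decompose 𝒜 a d : A) ∈ 𝔞 := by
    have := coeff_mem_of_mem_map hρa' d
    rwa [coeff_coaction 𝒜 ρ hρ] at this
  rw [h𝔞, Ideal.mem_comap, IsLocalization.algebraMap_mem_map_algebraMap_iff 𝔮.primeCompl] at hd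
  obtain ⟨t, ht, htd⟩ := hd
  exact ⟨t, ht, htd⟩

/-- **THE (hom) KERNEL FOR THE E2 CENTRE.**  `A` Noetherian `ℤʲ`-graded, `F` homogeneous, (c11)≤e and `JUnitInvariant`
for the pair `(ι, J)`.  If an ideal `I` is READ BY `J` at every associated prime `𝔮` of `A ⧸ I` AND at its homogeneous
core `𝔮*` — `A_𝔮` regular of dimension `≤ e`, `I·A_𝔮 = J(A_𝔮, F)_n`, `I·A_{𝔮*} = J(A_{𝔮*}, F)_n` — then `I` is
HOMOGENEOUS (twist-stability = `J_map_localization_homogeneousCore_eq`). [OURS · (o47-hom) ring kernel · DESIGN MEMO v0 §3 (G-6)] -/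
theorem isHomogeneous_of_J_reading_associatedPrimes {e : ℕ} {ι : (R : Type) → [CommRing R] → R → Ordinal.{0}}
    {J : (R : Type) → [CommRing R] → R → ℕ → Ideal R} (hc11 : IotaJEssSmoothCompatibleLE e ι J)
    (hJunit : JUnitInvariant J) {F : A} (hF : IsHomogeneousElem 𝒜 F) (I : Ideal A) (n : ℕ)
    (h : ∀ 𝔮 ∈ associatedPrimes A (A ⧸ I), ∀ (_ : 𝔮.IsPrime) (𝔮' : Ideal A) (_ : 𝔮'.IsPrime),
      𝔮' = (𝔮.homogeneousCore 𝒜).toIdeal →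
      IsRegularLocalRing (Localization.AtPrime 𝔮) ∧ ringKrullDim (Localization.AtPrime 𝔮) ≤ e ∧
        I.map (algebraMap A (Localization.AtPrime 𝔮)) = J (Localization.AtPrime 𝔮) (algebraMap A _ F) n ∧
        I.map (algebraMap A (Localization.AtPrime 𝔮')) = J (Localization.AtPrime 𝔮') (algebraMap A _ F) n) :
    I.IsHomogeneous 𝒜 := by
  refine isHomogeneous_of_twistStable_associatedPrimes 𝒜 I ?_
  intro 𝔮 h𝔮 h𝔮p 𝔮' h𝔮'p h𝔮' ρ hρ 𝔔 h𝔔p h𝔔 h1 h2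
  obtain ⟨hreg, hd, hJ, hJ'⟩ := h 𝔮 h𝔮 h𝔮p 𝔮' h𝔮'p h𝔮'
  haveI := hreg
  rw [hJ, hJ']
  exact (J_map_localization_homogeneousCore_eq 𝒜 𝔮 𝔮' hc11 hJunit hd hF ρ hρ 𝔔 h𝔔 h1 h2 n).symm.le

end E2Model

end Summit.ResolutionOfSingularities.ResolutionOfSingularities.Cruxes.HypersurfaceCentreConstruction.LocalEngine

end
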